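import Summits.BirchSwinnertonDyer.BirchSwinnertonDyer.Theorems.SignedLowerHalvesSprungLowerDivisibilityAtThreeKatoFineSporadicPrintX8VS
import HarnessLib

/-!
# Route `PrintX8VS`, RESPLIT (W-81′, option (C-i)) of crux K1 `SprungLowerDivisibilityAtThree` (item stmt-BirchSwinnertonDyer-19875):
# the GLUE item `SprungLowerDivisibilityAtThreeOfKatoSporadicParts` HOLDS

Cell `bsd-ssimc` (host) / lead `cruxlead-stmt-BirchSwinnertonDyer-19875` (g3; text prepared by g2). After the x8 resplit of 19875
(children C1′ `KatoFineLowerSporadicX8` = registered stub `stub_katoFineLowerSporadic` VERBATIM, C2R `CyclotomicLowerRestX8R` = S4b (v7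
text; closes the v8 pair S4b-cyc / S4b-T through the doors p621634), C4R `HeldInputsX8R` = S5), the glue item reads
`C1′ → C2R → C4R → SprungLowerDivisibilityAtThree`; it is the landed `PrintX8VS` copy of the v7 composition,
`ChromaticCommonZeros.sprungLowerDivisibilityAtThree_printX8VS_of_katoSporadic` (p617761, from p614828), by δ-unfolding of the three
child decls. CLOSES the glue item only; C1′ and C2R are OPEN cruxes (Kato 2004 Conj. 12.10 at the sporadic zeros of the Kato index resp.
Sprung 2012 Main Conj. 7.21 at the remaining cyclotomic common zeros), C4R is HELD; K1 / BSD / leaf X8 are NOT proved by anything here.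

References: [Kato2004Asterisque] Conj. 12.10 (p. 224); [Sprung2012] Main Conj. 7.21 (p. 1505); tree `…KatoFineSporadicPrintX8VS` (p617761),
`…KatoFineSporadic` (p614828), `Theses/PrintX8VS.lean` (resplit rev ≥ 10).
-/

set_option linter.dupNamespace false
set_option autoImplicit false

namespace Summit.BirchSwinnertonDyer.BirchSwinnertonDyer.Theorems.ChromaticCommonZeros

/-- **The resplit glue of K1 on route `PrintX8VS` holds**: `KatoFineLowerSporadicX8 → CyclotomicLowerRestX8R → HeldInputsX8R →
SprungLowerDivisibilityAtThree`, by the landed v7 composition (p617761 / p614828): the sporadic branch is Kato's colour-free fine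
inequality moved to the guard colour by the four-term identity, the cyclotomic branch is S4a (landed) or C2R, `(3)` is excluded by S3
(landed). Unconditional as an implication; closes the glue item and nothing else.
[cite: Kato2004Asterisque, Conj. 12.10 (p. 224)] [cite: Sprung2012, Thm. 7.14 (p. 1504), Prop. 7.19 and Main Conj. 7.21 (p. 1505)] -/
theorem sprungLowerDivisibilityAtThreeOfKatoSporadicParts_holds :
    Summit.BirchSwinnertonDyer.BirchSwinnertonDyer.Theses.PrintX8VS.SprungLowerDivisibilityAtThreeOfKatoSporadicParts :=
  fun hK hC2 hC4 => sprungLowerDivisibilityAtThree_printX8VS_of_katoSporadic hK hC2 hC4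

end Summit.BirchSwinnertonDyer.BirchSwinnertonDyer.Theorems.ChromaticCommonZeros
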